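import Literature.NumberTheory.EllipticCurves.DualExpEllipticRangeOfTateReciprocity
import Literature.NumberTheory.PAdicHodge.DualExpEllipticRestriction
import HarnessLib

/-!
# Kato's reciprocity law in TOWER FORM at the upper level: the formula for `T_pW|_{Γ_F}` gives the formula for `(T_pW|_{Γ_{F₀}})|_{Γ_F}`

Topic `NumberTheory/EllipticCurves`; namespace `Literature.NumberTheory.EllipticCurves`. THEOREMS ONLY (no definition, no named fact, no
instance, no `sorry`). Companion of `ReciprocityLawDescent` (brick D6) for the assembly of [REC-tower]
(`tatePairingPoint_eq_trace_expStar_log_tower`) at the cells of crux K★ `stmt-BirchSwinnertonDyer-22226`, memo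
`Cruxes/StarredOptimalManinUnitFiveSeven/Lines/kato-lever-K3-legendre.md` §8: the SECOND clause of [REC-tower] is phrased with the tree's TOWER
pairing `tatePairingPointTower` (`= ⟨H¹(T(γ)⁻¹) ·, ·⟩_F`, `γ = towerConjElement K₀ F₀ F`) and the tower dual exponential `expStarCoordTower`,
for ALL crossed homomorphisms of the tower representation; the kernel theorems of the line produce Kato's formula for the DIRECT representation
`T_pW|_{Γ_F}`. For a tower `K₀ ⊆ F₀ ⊆ F`, `F` a `p`-adic field, an elliptic curve `W/K₀` and `γ = towerConjElement K₀ F₀ F`: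

* `absGaloisRestrict_eq_conj_towerConjElement_inv` — `res_{F/K₀} σ = γ⁻¹ · res_{F₀/K₀}(res_{F/F₀} σ) · γ` (the conjugation identity in the
  direction consumed by `restrictConjHom` / `DualExpEllipticRestriction`, element `γ⁻¹`).
* ★ `expStarCoord_map_towerInv_eq_expStarCoordTower` — for a tower line datum `d` and EVERY tower cocycle `η`:
  `exp*_{d.map V(γ⁻¹)}(T(γ⁻¹) ∘ η) = exp*_d(η)` (transport invariance of the scalar dual exponential, `FilZeroLine.dualExpCoord_map`, under the
  Prop-1.2.3 binders of the tower representation).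
* ★★ `tatePairingPointTower_eq_trace_of_direct` — if Kato's formula holds over `F` for the DIRECT representation with line datum
  `d.map V(γ⁻¹)` and constant `c` (all `η'`, all `P`), then the [REC-tower] upper clause holds with the SAME constant:
  `⟨[η], P⟩_tower = Tr_{F/ℚ_p}(c · exp*_d(η) · log_ω P)` for all tower cocycles `η` and all `P ∈ E(F)`
  (`tatePairingPointTower_apply` + `cohomologyMap_oneCocycleClass` + the previous item).

BSD / K★ / [REC] / [REC-tower] are NOT proved by this file (it is the exact repackaging of one clause).

## References
* K. Kato, LNM 1553 (1993), Ch. II §1.2.4 (functoriality of `exp*`), Thm. 1.4.1. [Kato1993LNM1553]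
* J.-P. Serre, *Galois Cohomology* (1997), I §2.4 (compatible pairs), I §5.8. [SerreGaloisCohomology1997]
* J. Neukirch, A. Schmidt, K. Wingberg (2008), (7.2.6). [NeukirchSchmidtWingberg2008]
-/

noncomputable section

open scoped Classical NNReal
open CategoryTheory Function Field ValuativeRel
open Literature.NumberTheory.GaloisRepresentations
open Literature.NumberTheory.GaloisRepresentations.IsNonarchimedeanLocalField
open Literature.NumberTheory.GaloisRepresentations.PeriodRingData
open Literature.NumberTheory.PAdicHodge

namespace Literature.NumberTheory.EllipticCurves

open _root_.WeierstrassCurve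

variable {K₀ : Type} [Field K₀] [CharZero K₀] (W : WeierstrassCurve K₀) [W.IsElliptic]
  (F₀ : Type) [Field F₀] [Algebra K₀ F₀]
  (F : Type) [Field F] [Algebra K₀ F] [Algebra F₀ F] [IsScalarTower K₀ F₀ F]
  {p : ℕ} [Fact p.Prime]

/-! ### §1 The conjugation identity for `γ⁻¹` -/

omit [CharZero K₀] in
/-- `res_{F/K₀} σ = γ⁻¹ · (res_{F₀/K₀} ∘ res_{F/F₀}) σ · (γ⁻¹)⁻¹` for `γ = towerConjElement K₀ F₀ F` — the defining identity of the
conjugating element read in the direction `tower ↦ direct`. [cite: MilneFT2022, Ch. 7, footnote after Prop. 7.6] -/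
theorem absGaloisRestrict_eq_conj_towerConjElement_inv (σ : absoluteGaloisGroup F) :
    absGaloisRestrict K₀ F σ =
      (towerConjElement K₀ F₀ F)⁻¹ * ((absGaloisRestrict K₀ F₀).comp (absGaloisRestrict F₀ F)) σ * (towerConjElement K₀ F₀ F)⁻¹⁻¹ := by
  rw [absGaloisRestrict_comp_eq_conj K₀ F₀ F σ, inv_inv]
  group

variable {F}
variable [ValuativeRel F] [TopologicalSpace F] [IsNonarchimedeanLocalField F] [CharZero F]
  [Fact (¬ IsUnit (p : integerC F))] [IsAdicComplete (Ideal.span {(p : integerC F)}) (integerC F)]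
  (hp : valuation F p < 1) [Algebra ℚ_[p] F]
  {gV : W.rationalTateModule p ≃ₗ[ℚ_[p]] W.rationalTateModule p}
  (hgVdef : ∀ m, gV m = (W.rationalTateGaloisRep p (W.continuous_rationalGaloisRepTate_holds p)) (towerConjElement K₀ F₀ F)⁻¹ m)

/-! ### §2 `exp*` of the transported cocycle -/

omit [CharZero K₀] in
include hgVdef in
/-- ★ **`exp*_{d.map V(γ⁻¹)}(T(γ⁻¹) ∘ η) = exp*_d(η)`** for every crossed homomorphism `η` of the tower representation
`(T_pW|_{Γ_{F₀}})|_{Γ_F}`: the cocycle transported along `restrictedTateRepTowerIso⁻¹ = T(γ⁻¹)` to the direct representation `T_pW|_{Γ_F}`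
and the line datum transported along `V(γ⁻¹)` have the same scalar dual exponential (`FilZeroLine.dualExpCoord_map`), under the Prop-1.2.3
binders of the tower representation. [cite: Kato1993LNM1553, Ch. II §1.2.4 and Prop. 1.2.3] [cite: SerreGaloisCohomology1997, I §5.8] -/
theorem expStarCoord_map_towerInv_eq_expStarCoordTower
    (hinj : (bdRPeriodRingData (F := F) (p := p) hp).CupLogInjective (logCyclotomic p)
      ((restrictedRationalTateRep W F₀ p).restrict (absGaloisRestrict F₀ F)))
    (hde : ∀ z : contOneCocycles ((restrictedRationalTateRep W F₀ p).restrict (absGaloisRestrict F₀ F)).toTopRep,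
      (bdRPeriodRingData (F := F) (p := p) hp).HasDualExp (logCyclotomic p)
        ((restrictedRationalTateRep W F₀ p).restrict (absGaloisRestrict F₀ F)) fun σ => z.1 σ)
    (d : (bdRPeriodRingData (F := F) (p := p) hp).FilZeroLine ((restrictedRationalTateRep W F₀ p).restrict (absGaloisRestrict F₀ F)))
    (η : contOneCocycles ((restrictedTateRep W F₀ p).restrict (absGaloisRestrict F₀ F)).toTopRep) :
    expStarCoord W hp (d.map gV (ratGalEquiv_intertwines W F₀ (absGaloisRestrict_eq_conj_towerConjElement_inv F₀ F) hgVdef))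
        (contOneCocycles.pullback (ContinuousMonoidHom.id _) (resIdHom (restrictedTateRepTowerIso W F₀ F p).inv) η) =
      expStarCoordTower W hp d η := by
  -- the rational cochain of `η` is a continuous cocycle of the rational tower representation: its dual-exp existence
  have hz := hde ⟨⟨fun σ => TateModule.toRational p (η.1 σ),
      (by
        haveI := W.module_finite_tateModule_holds p
        exact (TateModule.continuous_toRational (A := geomPoints W) (p := p)).comp η.1.continuous)⟩,
    fun g h => by
      change TateModule.toRational p (η.1 (g * h)) = _
      rw [η.2 g h, map_add]
      rfl⟩
  have key := FilZeroLine.dualExpCoord_map d gV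
    (ratGalEquiv_intertwines W F₀ (absGaloisRestrict_eq_conj_towerConjElement_inv F₀ F) hgVdef) hinj
    (cupLogInjective_res_of_tower W F₀ hp (absGaloisRestrict_eq_conj_towerConjElement_inv F₀ F) hgVdef hinj) hz
  unfold expStarCoord expStarCoordTower
  refine Eq.trans (congrArg _ (funext fun σ => ?_)) key
  change TateModule.toRational p ((W.tateGaloisRep p (W.continuous_galoisRepTate_holds p)).toIntRep
      (towerConjElement K₀ F₀ F)⁻¹ (η.1 σ)) = gV (TateModule.toRational p (η.1 σ))
  rw [hgVdef]
  rfl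

/-! ### §3 The upper clause of [REC-tower] from the formula for the direct representation -/

variable (w : Valuation F ℝ≥0) [(W.baseChange F).IsIntegral w.integer]
  (e : (k : ℕ) → geomTorsion W ((p ^ k : ℕ) : ℤ) → geomTorsion W ((p ^ k : ℕ) : ℤ) → AlgebraicClosure K₀)
  (hμ : ∀ k S T, e k S T ^ (p ^ k) = 1) (hadd₁ : ∀ k S₁ S₂ T, e k (S₁ + S₂) T = e k S₁ T * e k S₂ T)
  (hadd₂ : ∀ k S T₁ T₂, e k S (T₁ + T₂) = e k S T₁ * e k S T₂)
  (hgal : ∀ k (σ : absoluteGaloisGroup K₀) (S T : geomTorsion W ((p ^ k : ℕ) : ℤ)), σ • e k S T = e k (σ • S) (σ • T))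
  (hcompat : ∀ k (S T : geomTorsion W ((p ^ (k + 1) : ℕ) : ℤ)),
    e k (torsionMulHom W (p ^ (k + 1)) (p ^ k) p (pow_succ p k).symm S)
      (torsionMulHom W (p ^ (k + 1)) (p ^ k) p (pow_succ p k).symm T) = e (k + 1) S T ^ p)

include hgVdef in
/-- ★★ **The upper clause of [REC-tower] from Kato's formula for the direct representation.** If
`⟨[η'], P⟩_F = Tr_{F/ℚ_p}(c · exp*_{d.map V(γ⁻¹)}(η') · log_ω P)` for every crossed homomorphism `η'` of `T_pW|_{Γ_F}` and every `P ∈ E(F)`,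
then for every crossed homomorphism `η` of the TOWER representation and every `P ∈ E(F)`:
`tatePairingPointTower … [η] P = Tr_{F/ℚ_p}(c · expStarCoordTower d η · log_ω P)` — the same constant `c`.
[cite: Kato1993LNM1553, Ch. II §1.2.4 and Thm. 1.4.1 (4)] [cite: NeukirchSchmidtWingberg2008, (7.2.6)] [cite: SerreGaloisCohomology1997, I §5.8] -/
theorem tatePairingPointTower_eq_trace_of_direct
    (hinj : (bdRPeriodRingData (F := F) (p := p) hp).CupLogInjective (logCyclotomic p)
      ((restrictedRationalTateRep W F₀ p).restrict (absGaloisRestrict F₀ F)))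
    (hde : ∀ z : contOneCocycles ((restrictedRationalTateRep W F₀ p).restrict (absGaloisRestrict F₀ F)).toTopRep,
      (bdRPeriodRingData (F := F) (p := p) hp).HasDualExp (logCyclotomic p)
        ((restrictedRationalTateRep W F₀ p).restrict (absGaloisRestrict F₀ F)) fun σ => z.1 σ)
    (d : (bdRPeriodRingData (F := F) (p := p) hp).FilZeroLine ((restrictedRationalTateRep W F₀ p).restrict (absGaloisRestrict F₀ F)))
    (c : F)
    (hrec : ∀ (η' : contOneCocycles (restrictedTateRep W F p).toTopRep) (P : (W.baseChange F).toAffine.Point),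
      ((tatePairingPoint W F p e hμ hadd₁ hadd₂ hgal hcompat (oneCocycleClass _ η') P : ℤ_[p]) : ℚ_[p]) =
        Algebra.trace ℚ_[p] F
          (c * expStarCoord W hp
              (d.map gV (ratGalEquiv_intertwines W F₀ (absGaloisRestrict_eq_conj_towerConjElement_inv F₀ F) hgVdef)) η' *
            FormalGroupChart.padicLogPointFiniteExt w (W.baseChange F) p P))
    (η : contOneCocycles ((restrictedTateRep W F₀ p).restrict (absGaloisRestrict F₀ F)).toTopRep)
    (P : (W.baseChange F).toAffine.Point) :
    ((tatePairingPointTower W F₀ e hμ hadd₁ hadd₂ hgal hcompat (oneCocycleClass _ η) P : ℤ_[p]) : ℚ_[p]) =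
      Algebra.trace ℚ_[p] F
        (c * expStarCoordTower W hp d η * FormalGroupChart.padicLogPointFiniteExt w (W.baseChange F) p P) := by
  rw [tatePairingPointTower_apply, cohomologyMap_oneCocycleClass, hrec,
    expStarCoord_map_towerInv_eq_expStarCoordTower W F₀ hp hgVdef hinj hde d η]

/-! ### §4 The intertwiner `V(γ⁻¹)` exists -/

omit [CharZero K₀] [ValuativeRel F] [TopologicalSpace F] [IsNonarchimedeanLocalField F] [CharZero F]
  [Fact (¬ IsUnit (p : integerC F))] [IsAdicComplete (Ideal.span {(p : integerC F)}) (integerC F)] [Algebra ℚ_[p] F] in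
/-- The linear automorphism `V(γ⁻¹)` of `V_pW` consumed above exists (`exists_ratGalEquiv` at `γ⁻¹`). [cite: SerreGaloisCohomology1997, I §2.4 (compatible pairs)] -/
theorem exists_ratGalEquiv_towerConjElement_inv :
    ∃ gV : W.rationalTateModule p ≃ₗ[ℚ_[p]] W.rationalTateModule p,
      ∀ m, gV m = (W.rationalTateGaloisRep p (W.continuous_rationalGaloisRepTate_holds p)) (towerConjElement K₀ F₀ F)⁻¹ m :=
  exists_ratGalEquiv W (towerConjElement K₀ F₀ F)⁻¹

/-! ### §5 The Prop-1.2.3 existence binder passes to the direct representation -/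

omit [CharZero K₀] in
include hgVdef in
/-- **`HasDualExp` for every continuous crossed homomorphism of the TOWER representation implies it for every continuous crossed
homomorphism of the DIRECT representation `V_pW|_{Γ_F}`** (pull back along `V(γ) = V(γ⁻¹)⁻¹`, push forward along `V(γ⁻¹)`,
`HasDualExp.map`); with `cupLogInjective_res_of_tower` this feeds BOTH Prop-1.2.3 binders of [REC] over `F` (direct representation) from
those of [REC-tower] (tower representation). [cite: Kato1993LNM1553, Ch. II §1.2.4 and Prop. 1.2.3] -/
theorem hasDualExp_direct_of_tower
    (hde : ∀ z : contOneCocycles ((restrictedRationalTateRep W F₀ p).restrict (absGaloisRestrict F₀ F)).toTopRep,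
      (bdRPeriodRingData (F := F) (p := p) hp).HasDualExp (logCyclotomic p)
        ((restrictedRationalTateRep W F₀ p).restrict (absGaloisRestrict F₀ F)) fun σ => z.1 σ)
    (z' : contOneCocycles (restrictedRationalTateRep W F p).toTopRep) :
    (bdRPeriodRingData (F := F) (p := p) hp).HasDualExp (logCyclotomic p) (restrictedRationalTateRep W F p) fun σ => z'.1 σ := by
  have hgV := ratGalEquiv_intertwines W F₀ (absGaloisRestrict_eq_conj_towerConjElement_inv F₀ F) hgVdef
  -- `V(γ⁻¹)⁻¹` intertwines backwards and is `V(γ)`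
  have hsymm : ∀ (σ : absoluteGaloisGroup F) (m' : W.rationalTateModule p), gV.symm (restrictedRationalTateRep W F p σ m') =
      ((restrictedRationalTateRep W F₀ p).restrict (absGaloisRestrict F₀ F)) σ (gV.symm m') := fun σ m' =>
    gV.injective (by rw [LinearEquiv.apply_symm_apply, hgV, LinearEquiv.apply_symm_apply])
  have hsymm_def : ∀ m', gV.symm m' =
      (W.rationalTateGaloisRep p (W.continuous_rationalGaloisRepTate_holds p)) (towerConjElement K₀ F₀ F) m' := fun m' =>
    gV.injective (by
      rw [LinearEquiv.apply_symm_apply, hgVdef, ← Module.End.mul_apply, ← map_mul, inv_mul_cancel, map_one,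
        Module.End.one_apply])
  -- pull `z'` back to a continuous crossed homomorphism of the tower representation
  let z₀ : contOneCocycles ((restrictedRationalTateRep W F₀ p).restrict (absGaloisRestrict F₀ F)).toTopRep :=
    ⟨⟨fun σ => gV.symm (z'.1 σ), by
        rw [show (fun σ => gV.symm (z'.1 σ)) = fun σ =>
            (W.rationalTateGaloisRep p (W.continuous_rationalGaloisRepTate_holds p)) (towerConjElement K₀ F₀ F) (z'.1 σ) from
          funext fun σ => hsymm_def _]
        exact ((W.rationalTateGaloisRep p (W.continuous_rationalGaloisRepTate_holds p)).continuous_apply _).comp z'.1.continuous⟩,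
      fun g h => by
        change gV.symm (z'.1 (g * h)) =
          gV.symm (z'.1 g) + ((restrictedRationalTateRep W F₀ p).restrict (absGaloisRestrict F₀ F)) g (gV.symm (z'.1 h))
        rw [z'.2 g h, map_add]
        congr 1
        exact hsymm g (z'.1 h)⟩
  have h := HasDualExp.map (φ := (gV : W.rationalTateModule p →ₗ[ℚ_[p]] W.rationalTateModule p)) hgV (hde z₀)
  have hfun : (fun σ => (gV : W.rationalTateModule p →ₗ[ℚ_[p]] W.rationalTateModule p) (z₀.1 σ)) = fun σ => z'.1 σ :=
    funext fun σ => gV.apply_symm_apply (z'.1 σ)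
  rw [hfun] at h
  exact h

end Literature.NumberTheory.EllipticCurves

end
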